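/-
Copyright (c) 2026 the pub-hodgecm-mathlib formalisation cell (harness21).  Prover seat hodgecm-mathlib-K2E5-p17 (g5), Track B «K2-LIT» ∕ h413
(`stmt-HodgeConjecture-24833`), line `K2_E3_EllipticInputs`, road «GL₂-sc» (road owner K2E5-p17 (g5); dealer D66), brick (2A-2): THE ASSEMBLY — Harish-Chandra's
local integrability for SUPERCUSPIDAL `GL₂(F)`, hypothesis-first on Harish-Chandra's Theorem 16 on `GL₂(F) ⧸ ϖ^ℤ·1`.  2026-09-04.
-/
import Summits.HodgeConjecture.HodgeConjecture.Theorems.K2E3GL3SupercuspidalCharLocInt      -- ★ B6-final (GL₃ template): GENERIC `isSupercuspidal_twist`; brings ★ B0b, ★ B0c (d), ★ B0z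
import Summits.HodgeConjecture.HodgeConjecture.Theorems.K2E3GL2ModCocompactFrame             -- ★ 2F-b″ p858833 (this seat): frame of `GL₂(F) ⧸ Λ·1`; brings ★ 2F-a, 2F-b, 2F-b′
import Summits.HodgeConjecture.HodgeConjecture.Theorems.K2E3GL2SupercuspidalTwistDescent     -- ★ 2F-c p858779 (this seat): unramified twist + descent at `N = 2`
import Summits.HodgeConjecture.HodgeConjecture.Theorems.K2E3LocalFieldValuedOfValuativeRel   -- ★ 2F-v p858949 (this seat): `ValuativeRel` frame → `Valued F ℤᵐ⁰` frame
import Summits.HodgeConjecture.HodgeConjecture.Theorems.K2E3GL2ModCocompactCharLocInt       -- ★ 2A-1 p858999 + ED. 2 p859006 (K2E3-p21 (g6)): (HC16₂) ⟸ `hNE₂` (`charLocIntNear_quotScalar_of_nonell_estimates`) [ED. 2]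
import HarnessLib

/-!
# Road «GL₂-sc», brick (2A-2): Harish-Chandra's local integrability for SUPERCUSPIDAL `GL₂(F)` — the assembly, modulo Theorem 16 on `GL₂(F) ⧸ ϖ^ℤ·1`

Cell `pub/hodgecm-mathlib` (D-0151), Track B, seat K2E5-p17 (g5), ROAD OWNER «GL₂-sc» (dealer K2E3-plan (g4) RULINGS #1 (R-2), deal D66; BRICK LIST v1.1
`K2/K2E5-p17/g5/BRICKLIST-GL2sc-v1.1.K2E5-p17-g5.md`).  `--supports stmt-HodgeConjecture-24833 --as helper`; THEOREMS ONLY (no definition ∕ instance ∕ notation ∕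
named fact ∕ `sorry`); never imports `Cruxes/…/Lines`.  COUNT-NEUTRAL.

THE PAYER FILE of the hosted leaf (S-C′-GL₂sc) `sig_K2E3GL2SupercuspidalCharLocInt` (U12 ED. 24 :520): for `F` a non-archimedean local field of characteristic `0`
and `ρ` an irreducible smooth admissible supercuspidal representation of `GL₂(F)`, the character of `ρ` is an integrable function near every `g ∈ GL₂(F)`.  This
file is the `N = 2` twin of ★ B6-final `K2E3GL3SupercuspidalCharLocInt` (road «GL-[M6]-sc», K2E3-p23 (g5)), typed HYPOTHESIS-FIRST on ONE clean input —
**(HC16₂)** Harish-Chandra's Theorem 16 on the compact-centre quotient `G' := GL₂(F) ⧸ ϖ^ℤ·1`: «for every Haar measure `μ` on `G'` and every SUPERCUSPIDAL class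
`c` of `G'`, every `s ∈ G'` has an open `U ∋ s` and `Θ ∈ L¹(U, μ)` with `χ_c(f) = ∫ f Θ dμ` for all test functions supported in `U`» — which is exactly what brick
(2A-1) `K2E3GL2ModCocompactCharLocInt` (twin of ★ B6-core, K2E3-p21 (g6)) delivers from the elliptic package (2E-c) and the NON-ELLIPTIC estimates `hNE₂`
(`K2E3GL2ModUniformizerNonEllEstimates`, K2E3-p23 (g6), bricks 2N-0…2N-7); the 10-line hypothesis-free closer is appended to THIS file when they are ★.
Chain (all ★, this seat's `N = 2` twins): unramified twist `r₁ = r₀ ⊗ χ∘det` trivial on `ϖ·1` (★ 2F-c `exists_unramified_twist_apply_scalar_eq_one`) ↦ descent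
`r♭` to `G'` (★ 2F-c `exists_smoothIrrep_quotScalar`) ↦ frame of `G'` (★ 2F-b″: nonarchimedean, Hausdorff, inversion-invariant Haar; ★ B0z: `ϖ^ℤ` closed,
`F^× ⧸ ϖ^ℤ` compact) ↦ (HC16₂) at `mk g` for `[r♭]` ↦ ★ B0b covering transport along `mk` (kernel `ϖ^ℤ·1` discrete: `GL₂(𝒪) ∩ ϖ^ℤ·1 = 1`, §1) ↦ `r♭ ∘ mk ≃ r₁`
↦ ★ B0c (d) untwist (`K2E3SmoothTraceTwist.charLocIntNear_of_twist`).

* §1 `eq_one_of_mem_glInt_of_mk_eq_one` — `GL₂(𝒪) ∩ ϖ^ℤ·1 = 1` (`det (ϖ^k·1) = ϖ^{2k}` is a unit only for `k = 0`).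
* §2 **`charLocIntNear_gl2_supercuspidal_of_quotUniformizer`** — the assembly in the `[Valued F ℤᵐ⁰]` frame, `SmoothIrrep` form, for a FIXED uniformiser `ϖ`,
  hypothesis-first on (HC16₂) for `GL₂(F) ⧸ ϖ^ℤ·1`.
* §3 **`charLocIntNear_gl2_supercuspidal_rep_of_quotUniformizer`** — THE SOCKET SHAPE: conclusion = the bytes of `sig_K2E3GL2SupercuspidalCharLocInt` VERBATIM
  (`ValuativeRel` frame, Representation form, ∀-closed over `F V : Type`), hypothesis = (HC16₂) ∀-closed over all `p`-adic fields in the `Valued` frame and all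
  uniformisers; the frames are bridged INSIDE the proof by ★ 2F-v `exists_valuation_int_compatible` (`letI : Valued F ℤᵐ⁰ := {‹UniformSpace F› with v, …}`).

HONEST LABEL: HC_CM is proved only modulo the 7 printed citations (2 remaining named inputs: hLiu418 = stmt-HodgeConjecture-24832, h413 =
stmt-HodgeConjecture-24833) until rung 0 closes; count-neutral (kernel lane); CONDITIONAL on (HC16₂) = bricks 2A-1 ∕ 2E-c ∕ 2N-* (OPEN, being typed).

References: Harish-Chandra (van Dijk) 1970, Part VII Thm 16 p. 67, Thm p. 99 [cite: HarishChandra1970, Part VII Thm 16 p. 67]; Harish-Chandra 1999 (DeBacker–Sally),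
Thm 16.3 p. 77 [cite: HarishChandra1999AdmissibleDistributions, Thm. 16.3 p. 77]; Bushnell–Henniart 2006 §9.1 (twists), §2.6 (Schur) [cite: BushnellHenniart2006, §9.1];
Platonov–Rapinchuk 1994 §3.3 (`GLₙ(𝒪)` compact open) [cite: PlatonovRapinchuk1994, §3.3].
-/

open MeasureTheory MeasureTheory.Measure Set Function Filter
open scoped NNReal ENNReal MatrixGroups Pointwise WithZero Valued Topology
open Matrix ValuativeRel
open Literature.NumberTheory.Automorphic Literature.NumberTheory.GaloisRepresentations Literature.NumberTheory.GaloisRepresentations.IsNonarchimedeanLocalField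
open Summit.HodgeConjecture.HodgeConjecture.Cruxes.H413.K2E3GL2ModCentre Summit.HodgeConjecture.HodgeConjecture.Cruxes.H413.K2E3GL2ModCocompactCentral
open Summit.HodgeConjecture.HodgeConjecture.Cruxes.H413.K2E3GL2ModCocompactUnimodular Summit.HodgeConjecture.HodgeConjecture.Cruxes.H413.K2E3GL2ModCocompactFrame
open Summit.HodgeConjecture.HodgeConjecture.Cruxes.H413.K2E3GL2SupercuspidalTwistDescent

set_option autoImplicit false
set_option linter.dupNamespace false   -- `Summit.HodgeConjecture.HodgeConjecture.…` (D-0017 nested layout; lakefile exemption for Summits)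

noncomputable section

namespace Summit.HodgeConjecture.HodgeConjecture.Cruxes.H413.K2E3GL2SupercuspidalCharLocInt

/-! ## §1 The kernel `ϖ^ℤ·1` meets `GL₂(𝒪)` trivially -/

section Aux

variable {F : Type*} [Field F] [Valued F ℤᵐ⁰] [ValuativeRel F] [(Valued.v : Valuation F ℤᵐ⁰).Compatible]

/-- **`GL₂(𝒪) ∩ ϖ^ℤ·1 = 1`**: an element of `GL₂(𝒪)` that dies in `GL₂(F) ⧸ ϖ^ℤ·1` is `1` (`det (ϖ^k·1) = ϖ^{2k}` is a unit only for `k = 0`) — the discreteness input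
`hker` of the ★ covering transport B0b; `N = 2` twin of ★ `K2E3GL3SupercuspidalCharLocInt.eq_one_of_mem_glInt_of_mk_eq_one`. [cite: PlatonovRapinchuk1994, §3.3] -/
theorem eq_one_of_mem_glInt_of_mk_eq_one {ϖ : F} (hϖ : Valued.v ϖ = WithZero.exp (-1 : ℤ)) (hϖ0 : ϖ ≠ 0)
    [((Subgroup.zpowers (Units.mk0 ϖ hϖ0)).map (Matrix.GeneralLinearGroup.scalar (Fin 2))).Normal]
    {x : GL (Fin 2) F} (hx : x ∈ glInt 2 F)
    (h1 : (QuotientGroup.mk x : GL (Fin 2) F ⧸ (Subgroup.zpowers (Units.mk0 ϖ hϖ0)).map (Matrix.GeneralLinearGroup.scalar (Fin 2))) = 1) : x = 1 := by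
  rw [QuotientGroup.eq_one_iff] at h1
  obtain ⟨u, hu, rfl⟩ := Subgroup.mem_map.1 h1
  obtain ⟨k, rfl⟩ := Subgroup.mem_zpowers_iff.1 hu
  have hdet := valuation_det_eq_one_of_mem_glInt hx
  rw [← v_eq_one_iff_valuation_eq_one, ← Matrix.GeneralLinearGroup.val_det_apply, det_scalar_eq_pow, ← zpow_natCast, ← _root_.zpow_mul,
    K2E3GL3ModUniformizerCocompact.v_units_zpow_uniformizer hϖ hϖ0, WithZero.exp_eq_one, neg_eq_zero] at hdet
  have hk : k = 0 := by
    have h2 : k * ((2 : ℕ) : ℤ) = 0 := hdet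
    simpa using h2
  subst hk
  rw [zpow_zero, map_one]

end Aux

/-! ## §2 The assembly on `GL₂(F)` in the `Valued` frame, for a fixed uniformiser -/

section Main

variable {F : Type*} [Field F] [Valued F ℤᵐ⁰] [ValuativeRel F] [(Valued.v : Valuation F ℤᵐ⁰).Compatible] [IsNonarchimedeanLocalField F]

/-- **(GL₂-sc, 2A-2) LOCAL INTEGRABILITY OF SUPERCUSPIDAL CHARACTERS OF `GL₂(F)` NEAR EVERY POINT, MODULO HARISH-CHANDRA'S THEOREM 16 ON `GL₂(F) ⧸ ϖ^ℤ·1`.**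
`hG'` = (HC16₂): for every Haar measure `μ` on `G' = GL₂(F) ⧸ ϖ^ℤ·1` and every supercuspidal class `c` of `G'`, at every `s ∈ G'` an open `U ∋ s` and `Θ ∈ L¹(U, μ)`
with `χ_c(f) = ∫ f Θ dμ` for all test functions supported in `U` (brick 2A-1 from 2E-c + `hNE₂`; Harish-Chandra 1970 Thm 16 with Thms 14, 18–20).  CONCLUSION: for
every Haar `μ₀` on `GL₂(F)`, every admissible supercuspidal irreducible `r₀`, every `g`: an open `U ∋ g`, `Θ ∈ L¹(U, μ₀)`, `χ_{[r₀]}(f) = ∫ f Θ dμ₀` for all test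
functions supported in `U`.  Proof = the ★ chain 2F-c (twist, descend) → 2F-b″∕B0z (frame) → `hG'` → B0b (covering transport, §1) → B0c (d) (untwist).
[cite: HarishChandra1970, Part VII Thm 16 p. 67] [cite: HarishChandra1999AdmissibleDistributions, Thm. 16.3 p. 77] [cite: BushnellHenniart2006, §9.1] -/
theorem charLocIntNear_gl2_supercuspidal_of_quotUniformizer {ϖ : F} (hϖ : Valued.v ϖ = WithZero.exp (-1 : ℤ)) (hϖ0 : ϖ ≠ 0)
    [((Subgroup.zpowers (Units.mk0 ϖ hϖ0)).map (Matrix.GeneralLinearGroup.scalar (Fin 2))).Normal]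
    (hG' : ∀ [MeasurableSpace (GL (Fin 2) F ⧸ (Subgroup.zpowers (Units.mk0 ϖ hϖ0)).map (Matrix.GeneralLinearGroup.scalar (Fin 2)))]
      [BorelSpace (GL (Fin 2) F ⧸ (Subgroup.zpowers (Units.mk0 ϖ hϖ0)).map (Matrix.GeneralLinearGroup.scalar (Fin 2)))]
      (μ : Measure (GL (Fin 2) F ⧸ (Subgroup.zpowers (Units.mk0 ϖ hϖ0)).map (Matrix.GeneralLinearGroup.scalar (Fin 2)))) [μ.IsHaarMeasure]
      (c : IrrClass (GL (Fin 2) F ⧸ (Subgroup.zpowers (Units.mk0 ϖ hϖ0)).map (Matrix.GeneralLinearGroup.scalar (Fin 2)))), c.IsSupercuspidal →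
      ∀ s : GL (Fin 2) F ⧸ (Subgroup.zpowers (Units.mk0 ϖ hϖ0)).map (Matrix.GeneralLinearGroup.scalar (Fin 2)),
        ∃ U : Set (GL (Fin 2) F ⧸ (Subgroup.zpowers (Units.mk0 ϖ hϖ0)).map (Matrix.GeneralLinearGroup.scalar (Fin 2))), IsOpen U ∧ s ∈ U ∧
          ∃ Θ : (GL (Fin 2) F ⧸ (Subgroup.zpowers (Units.mk0 ϖ hϖ0)).map (Matrix.GeneralLinearGroup.scalar (Fin 2))) → ℂ, IntegrableOn Θ U μ ∧
            ∀ f : (GL (Fin 2) F ⧸ (Subgroup.zpowers (Units.mk0 ϖ hϖ0)).map (Matrix.GeneralLinearGroup.scalar (Fin 2))) → ℂ,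
              f ∈ SchwartzBruhat (GL (Fin 2) F ⧸ (Subgroup.zpowers (Units.mk0 ϖ hϖ0)).map (Matrix.GeneralLinearGroup.scalar (Fin 2))) → tsupport f ⊆ U →
                c.smoothTrace μ f = ∫ y, f y * Θ y ∂μ)
    [MeasurableSpace (GL (Fin 2) F)] [BorelSpace (GL (Fin 2) F)] (μ₀ : Measure (GL (Fin 2) F)) [μ₀.IsHaarMeasure]
    (r₀ : SmoothIrrep (GL (Fin 2) F)) (hadm : r₀.ρ.IsAdmissible) (hsc : r₀.ρ.IsSupercuspidal) (g : GL (Fin 2) F) :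
    ∃ U : Set (GL (Fin 2) F), IsOpen U ∧ g ∈ U ∧ ∃ Θ : GL (Fin 2) F → ℂ, IntegrableOn Θ U μ₀ ∧
      ∀ f : GL (Fin 2) F → ℂ, f ∈ SchwartzBruhat (GL (Fin 2) F) → tsupport f ⊆ U → (IrrClass.mk r₀).smoothTrace μ₀ f = ∫ x, f x * Θ x ∂μ₀ := by
  -- §0 frame on `GL₂(F)`
  haveI : IsTopologicalRing F := inferInstance
  haveI : T2Space F := (isLocalField F).toT2Space
  haveI : SecondCountableTopology (GL (Fin 2) F) := secondCountableTopology_gl2 F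
  haveI : LocallyCompactSpace (GL (Fin 2) F) := locallyCompactSpace_gl2 F
  haveI : NonarchimedeanGroup (GL (Fin 2) F) := nonarchimedeanGroup_gl F 2
  -- §1 the unramified twist `r₁ = r₀ ⊗ χ∘det`, trivial on `ϖ·1` (★ 2F-c)
  obtain ⟨χ, hχdet, -, -, hr₁⟩ := exists_unramified_twist_apply_scalar_eq_one hϖ hϖ0 r₀ hadm
  have hadm₁ : (r₀.twist (χ.comp Matrix.GeneralLinearGroup.det) hχdet).ρ.IsAdmissible := hadm.twist hχdet
  have hsc₁ : (r₀.twist (χ.comp Matrix.GeneralLinearGroup.det) hχdet).ρ.IsSupercuspidal :=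
    K2E3GL3SupercuspidalCharLocInt.isSupercuspidal_twist hsc hχdet
  -- §2 the descent `r♭` to `G'` (★ 2F-c)
  obtain ⟨r', e, he, hsc', hadm'⟩ := exists_smoothIrrep_quotScalar hϖ0 (r₀.twist (χ.comp Matrix.GeneralLinearGroup.det) hχdet) hr₁
  have hsc'' := hsc' hsc₁
  have hadm'' := hadm' hadm₁
  -- §3 the frame of `G'` (★ 2F-b″, ★ B0z)
  letI : MeasurableSpace (GL (Fin 2) F ⧸ (Subgroup.zpowers (Units.mk0 ϖ hϖ0)).map (Matrix.GeneralLinearGroup.scalar (Fin 2))) := borel _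
  haveI : BorelSpace (GL (Fin 2) F ⧸ (Subgroup.zpowers (Units.mk0 ϖ hϖ0)).map (Matrix.GeneralLinearGroup.scalar (Fin 2))) := ⟨rfl⟩
  haveI : NonarchimedeanGroup (GL (Fin 2) F ⧸ (Subgroup.zpowers (Units.mk0 ϖ hϖ0)).map (Matrix.GeneralLinearGroup.scalar (Fin 2))) :=
    nonarchimedeanGroup_quotScalar _
  haveI : CompactSpace (Fˣ ⧸ Subgroup.zpowers (Units.mk0 ϖ hϖ0)) := K2E3GL3ModUniformizerCocompact.compactSpace_units_quot_zpowers_uniformizer hϖ hϖ0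
  have hΛ : IsClosed ((Subgroup.zpowers (Units.mk0 ϖ hϖ0) : Subgroup Fˣ) : Set Fˣ) := K2E3GL3ModUniformizerCocompact.isClosed_zpowers_uniformizer hϖ hϖ0
  haveI : T2Space (GL (Fin 2) F ⧸ (Subgroup.zpowers (Units.mk0 ϖ hϖ0)).map (Matrix.GeneralLinearGroup.scalar (Fin 2))) := t2Space_quotScalar _ hΛ
  set μ' : Measure (GL (Fin 2) F ⧸ (Subgroup.zpowers (Units.mk0 ϖ hϖ0)).map (Matrix.GeneralLinearGroup.scalar (Fin 2))) := Measure.haar with hμ'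
  -- §4 (HC16₂) at `mk g` for the class of `r♭`
  have hc' : (IrrClass.mk r').IsSupercuspidal := by rw [IrrClass.isSupercuspidal_mk]; exact hsc''
  have hG'' := hG' μ' (IrrClass.mk r') hc' (QuotientGroup.mk g)
  rw [IrrClass.smoothTrace_mk] at hG''
  -- §5 the covering transport along `mk : GL₂(F) → G'` (★ B0b)
  have hker : ∃ O ∈ 𝓝 (1 : GL (Fin 2) F), ∀ x ∈ O,
      (QuotientGroup.mk' ((Subgroup.zpowers (Units.mk0 ϖ hϖ0)).map (Matrix.GeneralLinearGroup.scalar (Fin 2)))) x = 1 → x = 1 :=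
    ⟨glInt 2 F, (isOpen_glInt 2 F).mem_nhds (Subgroup.one_mem _), fun x hx h1 => eq_one_of_mem_glInt_of_mk_eq_one hϖ hϖ0 hx h1⟩
  have hρ1 := K2E3CharLocIntNearCoveringTransport.charLocIntNear_comp_of_isOpenMap
    (QuotientGroup.mk' ((Subgroup.zpowers (Units.mk0 ϖ hϖ0)).map (Matrix.GeneralLinearGroup.scalar (Fin 2))))
    QuotientGroup.continuous_mk QuotientGroup.isOpenMap_coe hker μ₀ μ' r'.ρ hadm'' g hG''
  -- §6 `r♭ ∘ mk ≃ r₁` (★ 2F-c's `e`): same character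
  have heqv : (r₀.twist (χ.comp Matrix.GeneralLinearGroup.det) hχdet).ρ.smoothTrace μ₀ =
      Representation.smoothTrace (r'.ρ.comp (QuotientGroup.mk' ((Subgroup.zpowers (Units.mk0 ϖ hϖ0)).map (Matrix.GeneralLinearGroup.scalar (Fin 2))))) μ₀ :=
    Representation.smoothTrace_eq_of_equiv
      (r'.ρ.comp (QuotientGroup.mk' ((Subgroup.zpowers (Units.mk0 ϖ hϖ0)).map (Matrix.GeneralLinearGroup.scalar (Fin 2)))) :
        Representation ℂ (GL (Fin 2) F) r'.V) μ₀
      (Representation.Equiv.mk e fun x => LinearMap.ext fun v => he x v)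
  have h₁ : ∃ U : Set (GL (Fin 2) F), IsOpen U ∧ g ∈ U ∧ ∃ Θ : GL (Fin 2) F → ℂ, IntegrableOn Θ U μ₀ ∧
      ∀ f : GL (Fin 2) F → ℂ, f ∈ SchwartzBruhat (GL (Fin 2) F) → tsupport f ⊆ U →
        (IrrClass.mk (r₀.twist (χ.comp Matrix.GeneralLinearGroup.det) hχdet)).smoothTrace μ₀ f = ∫ x, f x * Θ x ∂μ₀ := by
    obtain ⟨U, hU, hgU, Θ, hΘ, hch⟩ := hρ1
    refine ⟨U, hU, hgU, Θ, hΘ, fun f hf hfU => ?_⟩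
    rw [IrrClass.smoothTrace_mk, heqv]
    exact hch f hf hfU
  -- §7 untwist (★ B0c (d))
  exact K2E3SmoothTraceTwist.charLocIntNear_of_twist μ₀ r₀ hadm (χ.comp Matrix.GeneralLinearGroup.det) hχdet g h₁

end Main

/-! ## §3 The socket shape: `ValuativeRel` frame, Representation form -/

section Socket

open MonoidWithZeroHom MonoidWithZeroHom.ValueGroup₀ in
/-- **The `Valued.is_topological_valuation` field from a `ℤᵐ⁰`-basis of `𝓝 0`.**  For a NORMALISED valuation `v : F → ℤᵐ⁰` (`v ϖ = exp(−1)`, so every `exp(−n)` is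
a value `v(ϖⁿ)`) whose sub-level sets `{v < γ}` (`γ ∈ ℤᵐ⁰ˣ`) form a basis of `𝓝 0`, the sub-level sets of the RESTRICTED valuation `v.restrict : F → ValueGroup₀(v)`
(Mathlib's current phrasing of `Valued`) form the same basis (`v.restrict x < v.restrict y ↔ v x < v y`, `v.restrict x < δ ↔ v x < embedding δ`).
[cite: Serre1979, Ch. II §1] -/
theorem nhds_zero_iff_restrict_of_int {F : Type*} [Field F] [TopologicalSpace F] {v : Valuation F ℤᵐ⁰}
    (hvt : ∀ s : Set F, s ∈ 𝓝 (0 : F) ↔ ∃ γ : ℤᵐ⁰ˣ, {x : F | v x < (γ : ℤᵐ⁰)} ⊆ s) {ϖ : F} (hϖ : v ϖ = WithZero.exp (-1 : ℤ)) (s : Set F) :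
    s ∈ 𝓝 (0 : F) ↔ ∃ γ : (ValueGroup₀ (MonoidWithZeroHom.ofClass v))ˣ, {x : F | v.restrict x < γ.1} ⊆ s := by
  rw [hvt]
  constructor
  · rintro ⟨γ, hγ⟩
    -- a power of `ϖ` of valuation `≤ γ`
    obtain ⟨n, hn⟩ : ∃ n : ℕ, -(n : ℤ) ≤ WithZero.log (γ : ℤᵐ⁰) :=
      ⟨(-WithZero.log (γ : ℤᵐ⁰)).toNat, by have := Int.self_le_toNat (-WithZero.log (γ : ℤᵐ⁰)); omega⟩
    have hvn : v (ϖ ^ n) = WithZero.exp (-(n : ℤ)) := by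
      rw [map_pow, hϖ, ← WithZero.exp_nsmul, nsmul_eq_mul, mul_neg, mul_one]
    have hvn0 : v.restrict (ϖ ^ n) ≠ 0 := by
      rw [Ne, Valuation.restrict_eq_zero_iff, hvn]; exact WithZero.exp_ne_zero
    refine ⟨Units.mk0 _ hvn0, fun x hx => hγ ?_⟩
    simp only [mem_setOf_eq, Units.val_mk0, Valuation.restrict_lt_iff] at hx ⊢
    refine lt_of_lt_of_le hx ?_
    rw [hvn, ← WithZero.exp_log γ.ne_zero, WithZero.exp_le_exp]
    exact hn
  · rintro ⟨γ, hγ⟩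
    have h0 : embedding (γ : ValueGroup₀ (MonoidWithZeroHom.ofClass v)) ≠ 0 := fun h =>
      γ.ne_zero (embedding_injective (by rw [h, map_zero]))
    refine ⟨Units.mk0 _ h0, fun x hx => hγ ?_⟩
    simp only [mem_setOf_eq, Units.val_mk0] at hx ⊢
    exact (Valuation.restrict_lt_iff_lt_embedding v).2 hx

/-- **(GL₂-sc, 2A-2, SOCKET SHAPE) `sig_K2E3GL2SupercuspidalCharLocInt` ⟸ (HC16₂).**  Conclusion = the bytes of the hosted leaf (S-C′-GL₂sc) VERBATIM (`ValuativeRel`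
frame, Representation form, ∀-closed over `F V : Type`).  Hypothesis `hG` = Harish-Chandra's Theorem 16 for supercuspidal classes of `GL₂(F) ⧸ ϖ^ℤ·1`, ∀-closed over
all non-archimedean local fields of characteristic `0` in the `Valued F ℤᵐ⁰` frame and all uniformisers `ϖ` (delivered by brick 2A-1 on 2E-c + `hNE₂`).  The two frames
are bridged inside the proof: ★ 2F-v `exists_valuation_int_compatible` gives a compatible normalised `ℤᵐ⁰`-valuation defining the topology, installed as
`Valued F ℤᵐ⁰ := {‹UniformSpace F› with …}` over the additive-group uniformity; then §2 applies to the `SmoothIrrep` bundling of `ρ`.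
[cite: HarishChandra1970, Part VII Thm 16 p. 67] [cite: HarishChandra1999AdmissibleDistributions, Thm. 16.3 p. 77] -/
theorem charLocIntNear_gl2_supercuspidal_rep_of_quotUniformizer
    (hG : ∀ (F : Type) [Field F] [Valued F ℤᵐ⁰] [ValuativeRel F] [(Valued.v : Valuation F ℤᵐ⁰).Compatible] [IsNonarchimedeanLocalField F] [CharZero F]
      (ϖ : F) (hϖ : Valued.v ϖ = WithZero.exp (-1 : ℤ)) (hϖ0 : ϖ ≠ 0)
      [((Subgroup.zpowers (Units.mk0 ϖ hϖ0)).map (Matrix.GeneralLinearGroup.scalar (Fin 2))).Normal]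
      [MeasurableSpace (GL (Fin 2) F ⧸ (Subgroup.zpowers (Units.mk0 ϖ hϖ0)).map (Matrix.GeneralLinearGroup.scalar (Fin 2)))]
      [BorelSpace (GL (Fin 2) F ⧸ (Subgroup.zpowers (Units.mk0 ϖ hϖ0)).map (Matrix.GeneralLinearGroup.scalar (Fin 2)))]
      (μ : Measure (GL (Fin 2) F ⧸ (Subgroup.zpowers (Units.mk0 ϖ hϖ0)).map (Matrix.GeneralLinearGroup.scalar (Fin 2)))) [μ.IsHaarMeasure]
      (c : IrrClass (GL (Fin 2) F ⧸ (Subgroup.zpowers (Units.mk0 ϖ hϖ0)).map (Matrix.GeneralLinearGroup.scalar (Fin 2)))), c.IsSupercuspidal →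
      ∀ s : GL (Fin 2) F ⧸ (Subgroup.zpowers (Units.mk0 ϖ hϖ0)).map (Matrix.GeneralLinearGroup.scalar (Fin 2)),
        ∃ U : Set (GL (Fin 2) F ⧸ (Subgroup.zpowers (Units.mk0 ϖ hϖ0)).map (Matrix.GeneralLinearGroup.scalar (Fin 2))), IsOpen U ∧ s ∈ U ∧
          ∃ Θ : (GL (Fin 2) F ⧸ (Subgroup.zpowers (Units.mk0 ϖ hϖ0)).map (Matrix.GeneralLinearGroup.scalar (Fin 2))) → ℂ, IntegrableOn Θ U μ ∧
            ∀ f : (GL (Fin 2) F ⧸ (Subgroup.zpowers (Units.mk0 ϖ hϖ0)).map (Matrix.GeneralLinearGroup.scalar (Fin 2))) → ℂ,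
              f ∈ SchwartzBruhat (GL (Fin 2) F ⧸ (Subgroup.zpowers (Units.mk0 ϖ hϖ0)).map (Matrix.GeneralLinearGroup.scalar (Fin 2))) → tsupport f ⊆ U →
                c.smoothTrace μ f = ∫ y, f y * Θ y ∂μ) :
    ∀ (F : Type) [Field F] [ValuativeRel F] [TopologicalSpace F] [IsNonarchimedeanLocalField F] [CharZero F]
      [MeasurableSpace (GL (Fin 2) F)] [BorelSpace (GL (Fin 2) F)] (μ : Measure (GL (Fin 2) F)) [μ.IsHaarMeasure]
      (V : Type) [AddCommGroup V] [Module ℂ V] (ρ : Representation ℂ (GL (Fin 2) F) V) [ρ.IsIrreducible],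
      ρ.IsSmooth → ρ.IsAdmissible → ρ.IsSupercuspidal → ∀ g : GL (Fin 2) F,
        ∃ U : Set (GL (Fin 2) F), IsOpen U ∧ g ∈ U ∧ ∃ Θ : GL (Fin 2) F → ℂ, IntegrableOn Θ U μ ∧
          ∀ f : GL (Fin 2) F → ℂ, f ∈ SchwartzBruhat (GL (Fin 2) F) → tsupport f ⊆ U → ρ.smoothTrace μ f = ∫ x, f x * Θ x ∂μ := by
  intro F _ _ _ _ _ _ _ μ _ V _ _ ρ _ hsm hadm hsc g
  -- the frame bridge (★ 2F-v): a compatible normalised `ℤᵐ⁰`-valuation defining the topology, over the additive-group uniformity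
  obtain ⟨v, hvc, hvt, ϖ, hϖ⟩ := K2E3LocalFieldValuedOfValuativeRel.exists_valuation_int_compatible F
  haveI : IsTopologicalRing F := inferInstance
  letI : UniformSpace F := IsTopologicalAddGroup.rightUniformSpace F
  haveI : IsUniformAddGroup F := isUniformAddGroup_of_addCommGroup
  letI : Valued F ℤᵐ⁰ := { v := v, is_topological_valuation := nhds_zero_iff_restrict_of_int hvt hϖ }
  haveI : (Valued.v : Valuation F ℤᵐ⁰).Compatible := hvc
  have hϖ0 : ϖ ≠ 0 := by
    rintro rfl
    rw [map_zero] at hϖ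
    exact WithZero.coe_ne_zero hϖ.symm
  haveI := normal_map_scalar (F := F) (Subgroup.zpowers (Units.mk0 ϖ hϖ0))
  -- bundle `ρ` and apply §2
  let r₀ : SmoothIrrep (GL (Fin 2) F) := { V := V, ρ := ρ, isIrreducible := ‹_›, isSmooth := hsm }
  have h := charLocIntNear_gl2_supercuspidal_of_quotUniformizer hϖ hϖ0 (fun μ' _ c hc => hG F ϖ hϖ hϖ0 μ' c hc) μ r₀ hadm hsc g
  rw [IrrClass.smoothTrace_mk] at h
  exact h

end Socket

/-! ## §4 (ED. 2) The socket reduced BY NAME to the non-elliptic estimates `hNE₂` alone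

★ 2A-1 `K2E3GL2ModCocompactCharLocInt.charLocIntNear_quotScalar_of_nonell_estimates` (K2E3-p21 (g6), ED. 2 p859006) delivers (HC16₂) on every `G_Λ` from the
NON-ELLIPTIC estimates at that Haar measure alone — the elliptic half (FC) on `GL₂(F) ⧸ Z` being ★ UNCONDITIONAL (2E-a1…a5, 2E-b1, 2E-b2, 2E-c).  Composing with §3:
the hosted leaf (S-C′-GL₂sc) follows from `hNE₂` = BRICK LIST v1.1 §1 bytes VERBATIM = the head `nonEllEstimates_modUniformizer` of brick (2N-7)
`K2E3GL2ModUniformizerNonEllEstimates` (NE half, K2E3-p23 (g6) + hands; Harish-Chandra 1970 Thms 18–20 + 15 at `N = 2`: ONE split torus, ONE parabolic).  The final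
closer is then the one-liner `charLocIntNear_gl2_supercuspidal_of_nonell K2E3GL2ModUniformizerNonEllEstimates.nonEllEstimates_modUniformizer` (ED. 3). -/

section OfNonEll

/-- **(GL₂-sc, 2A-2 ED. 2) `sig_K2E3GL2SupercuspidalCharLocInt` ⟸ `hNE₂`.**  Harish-Chandra's local integrability for every irreducible smooth admissible
supercuspidal representation of `GL₂(F)` (`F` non-archimedean local of characteristic `0`; conclusion = the hosted socket bytes VERBATIM), GIVEN ONLY the non-elliptic
estimates `hNE₂` on `G' = GL₂(F) ⧸ ϖ^ℤ·1` (∀-closed over all `p`-adic fields in the `Valued` frame and all uniformisers: for every Haar `μ` on `G'`, every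
supercuspidal `r`, every `r`-invariant sesquilinear `B`, every `v₁`, a compact exhaustion along which the truncated orbital integrals of `y ↦ B v₁ (r y v₁)` converge and
are dominated by an `L¹_loc` function a.e. OFF the compact-centraliser set).  Proof: §3 with `hG :=` ★ 2A-1 ED. 2 at `Λ₀ := ϖ^ℤ` (★ B0z: `ϖ^ℤ` closed, `F^× ⧸ ϖ^ℤ`
compact). [cite: HarishChandra1970, Part VII Thm 16 p. 67, Thms 18–20 pp. 69–70] [cite: HarishChandra1999AdmissibleDistributions, Thm. 16.3 p. 77] -/
theorem charLocIntNear_gl2_supercuspidal_of_nonell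
    (hNE₂ : ∀ (F : Type) [Field F] [Valued F ℤᵐ⁰] [ValuativeRel F] [(Valued.v : Valuation F ℤᵐ⁰).Compatible] [IsNonarchimedeanLocalField F] [CharZero F]
      (ϖ : F) (hϖ : Valued.v ϖ = WithZero.exp (-1 : ℤ)) (hϖ0 : ϖ ≠ 0)
      [((Subgroup.zpowers (Units.mk0 ϖ hϖ0)).map (Matrix.GeneralLinearGroup.scalar (Fin 2))).Normal]
      [MeasurableSpace (GL (Fin 2) F ⧸ (Subgroup.zpowers (Units.mk0 ϖ hϖ0)).map (Matrix.GeneralLinearGroup.scalar (Fin 2)))]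
      [BorelSpace (GL (Fin 2) F ⧸ (Subgroup.zpowers (Units.mk0 ϖ hϖ0)).map (Matrix.GeneralLinearGroup.scalar (Fin 2)))]
      (μ : Measure (GL (Fin 2) F ⧸ (Subgroup.zpowers (Units.mk0 ϖ hϖ0)).map (Matrix.GeneralLinearGroup.scalar (Fin 2)))) [μ.IsHaarMeasure]
      (r : SmoothIrrep (GL (Fin 2) F ⧸ (Subgroup.zpowers (Units.mk0 ϖ hϖ0)).map (Matrix.GeneralLinearGroup.scalar (Fin 2)))), r.ρ.IsSupercuspidal →
      ∀ (B : r.V →ₗ⋆[ℂ] r.V →ₗ[ℂ] ℂ),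
        (∀ (g : GL (Fin 2) F ⧸ (Subgroup.zpowers (Units.mk0 ϖ hϖ0)).map (Matrix.GeneralLinearGroup.scalar (Fin 2))) (x y : r.V), B (r.ρ g x) (r.ρ g y) = B x y) →
      ∀ (v₁ : r.V),
        ∃ (Ω : CompactExhaustion (GL (Fin 2) F ⧸ (Subgroup.zpowers (Units.mk0 ϖ hϖ0)).map (Matrix.GeneralLinearGroup.scalar (Fin 2))))
          (Fl : (GL (Fin 2) F ⧸ (Subgroup.zpowers (Units.mk0 ϖ hϖ0)).map (Matrix.GeneralLinearGroup.scalar (Fin 2))) → ℂ)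
          (M : (GL (Fin 2) F ⧸ (Subgroup.zpowers (Units.mk0 ϖ hϖ0)).map (Matrix.GeneralLinearGroup.scalar (Fin 2))) → ℝ),
          (∀ᵐ g ∂μ, ¬ IsCompact ((Subgroup.centralizer ({g} : Set (GL (Fin 2) F ⧸ (Subgroup.zpowers (Units.mk0 ϖ hϖ0)).map (Matrix.GeneralLinearGroup.scalar (Fin 2))))) :
              Set (GL (Fin 2) F ⧸ (Subgroup.zpowers (Units.mk0 ϖ hϖ0)).map (Matrix.GeneralLinearGroup.scalar (Fin 2)))) →
            Tendsto (fun n => ∫ x in Ω n, B v₁ (r.ρ (x * g * x⁻¹) v₁) ∂μ) atTop (𝓝 (Fl g))) ∧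
          (∀ n, ∀ᵐ g ∂μ, ¬ IsCompact ((Subgroup.centralizer ({g} : Set (GL (Fin 2) F ⧸ (Subgroup.zpowers (Units.mk0 ϖ hϖ0)).map (Matrix.GeneralLinearGroup.scalar (Fin 2))))) :
              Set (GL (Fin 2) F ⧸ (Subgroup.zpowers (Units.mk0 ϖ hϖ0)).map (Matrix.GeneralLinearGroup.scalar (Fin 2)))) →
            ‖∫ x in Ω n, B v₁ (r.ρ (x * g * x⁻¹) v₁) ∂μ‖ ≤ M g) ∧
          LocallyIntegrable M μ) :
    ∀ (F : Type) [Field F] [ValuativeRel F] [TopologicalSpace F] [IsNonarchimedeanLocalField F] [CharZero F]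
      [MeasurableSpace (GL (Fin 2) F)] [BorelSpace (GL (Fin 2) F)] (μ : Measure (GL (Fin 2) F)) [μ.IsHaarMeasure]
      (V : Type) [AddCommGroup V] [Module ℂ V] (ρ : Representation ℂ (GL (Fin 2) F) V) [ρ.IsIrreducible],
      ρ.IsSmooth → ρ.IsAdmissible → ρ.IsSupercuspidal → ∀ g : GL (Fin 2) F,
        ∃ U : Set (GL (Fin 2) F), IsOpen U ∧ g ∈ U ∧ ∃ Θ : GL (Fin 2) F → ℂ, IntegrableOn Θ U μ ∧
          ∀ f : GL (Fin 2) F → ℂ, f ∈ SchwartzBruhat (GL (Fin 2) F) → tsupport f ⊆ U → ρ.smoothTrace μ f = ∫ x, f x * Θ x ∂μ :=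
  charLocIntNear_gl2_supercuspidal_rep_of_quotUniformizer fun F _ _ _ _ _ _ ϖ hϖ hϖ0 _ _ _ μ _ c hc => by
    haveI : CompactSpace (Fˣ ⧸ Subgroup.zpowers (Units.mk0 ϖ hϖ0)) := K2E3GL3ModUniformizerCocompact.compactSpace_units_quot_zpowers_uniformizer hϖ hϖ0
    exact K2E3GL2ModCocompactCharLocInt.charLocIntNear_quotScalar_of_nonell_estimates _ hϖ
      (K2E3GL3ModUniformizerCocompact.isClosed_zpowers_uniformizer hϖ hϖ0) μ c hc (hNE₂ F ϖ hϖ hϖ0 μ)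

end OfNonEll

end Summit.HodgeConjecture.HodgeConjecture.Cruxes.H413.K2E3GL2SupercuspidalCharLocInt

end
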